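import Mathlib
import Summits.QuantumFields.QCD.Theorems.QuarksAsStableActionUnquenchedChessboardBoundStubChessboardAux
import HarnessLib

/-!
# The abstract chessboard estimate in letter form on the even four-torus of cells
(stub `stub_chessboard` of crux stmt-QuantumFields-9735, line Sketch)

Fröhlich–Israel–Lieb–Simon, Comm. Math. Phys. **62** (1978), Thms. 4.1/4.3, letter form, every even
period `N`, four axes: letters carry four commuting involutions `r i`, the universal pattern word of
a letter `a` is `x ↦ r^x a = r₀^{x₀} r₁^{x₁} r₂^{x₂} r₃^{x₃} a` (only the parities of the exponents
matter, and for even `N` the parity of a representative is additive: `iterate_val_add`,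
`iterate_val_reflect`), and `Φ` is a translation invariant real functional on words that is
reflection non-negative and reflection Cauchy–Schwarz through the cell boundaries `0 | N/2` of every
axis.  Then every pattern word has `Φ ≥ 0` and `|Φ w|^(N⁴) ≤ ∏_c Φ (pattern word of w c)`
(`stub_chessboard` is the registered statement; the generic-dimension extremal argument is
`stub_chessboardAux` of the auxiliary file).  The letter action is handled through any map `A`
agreeing pointwise with `r^x a` (`A_add`; `apply_A_cellReflect`: pattern words are reflection
symmetric; `phi_pat_A`: all letters of a pattern word have pattern words of the same `Φ`); no
definitions or named facts are introduced.

## References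

* J. Fröhlich, R. Israel, E. H. Lieb, B. Simon, Comm. Math. Phys. 62 (1978) 1–34, Thms. 4.1, 4.3
  [FrohlichIsraelLiebSimon1978].
* S. Friedli, Y. Velenik, *Statistical Mechanics of Lattice Systems*, CUP 2017, Theorem 10.11
  [FriedliVelenik2017].
* M. Biskup, LNM 1970 (2009), Thm. 5.8 [Biskup2009].
-/

noncomputable section

open Finset
open Literature.Barriers.CriticalPhenomena.NonGibbs

namespace Summit.QuantumFields.QCD.Theorems.UnquenchedChessboardBoundLine

namespace Chessboard

/-! ### Parities of representatives in `ℤ/Nℤ`, `N` even, and iterates of involutions -/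

section Parity

variable {N : ℕ} [NeZero N] {α : Type*} {f : α → α}

omit [NeZero N] in
/-- Iterates of an involution only depend on the parity of the exponent. [folklore] -/
theorem iterate_eq_iterate_of_natCast_eq (hf : Function.Involutive f) {m n : ℕ}
    (h : (m : ZMod 2) = n) : f^[m] = f^[n] := by
  rw [ZMod.natCast_eq_natCast_iff'] at h
  rcases Nat.even_or_odd m with hm | hm
  · have hn : Even n := by rw [Nat.even_iff] at hm ⊢; omega
    rw [hf.iterate_even hm, hf.iterate_even hn]
  · have hn : Odd n := by rw [Nat.odd_iff] at hm ⊢; omega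
    rw [hf.iterate_odd hm, hf.iterate_odd hn]

/-- For even `N`, the parity of the representative of `x : ℤ/Nℤ` is the reduction of `x` modulo `2`.
[folklore] -/
theorem natCast_val_eq_castHom (hN : Even N) (x : ZMod N) :
    ((x.val : ℕ) : ZMod 2) = ZMod.castHom hN.two_dvd (ZMod 2) x := by
  rw [ZMod.castHom_apply, ZMod.cast_eq_val]

/-- `f^{(u+v).val} = f^{u.val} ∘ f^{v.val}` for an involution `f` (`N` even). [folklore] -/
theorem iterate_val_add (hN : Even N) (hf : Function.Involutive f) (u v : ZMod N) (a : α) :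
    f^[(u + v).val] a = f^[u.val] (f^[v.val] a) := by
  rw [← Function.iterate_add_apply]
  refine congrFun (iterate_eq_iterate_of_natCast_eq hf ?_) a
  rw [natCast_val_eq_castHom hN, map_add, Nat.cast_add, natCast_val_eq_castHom hN,
    natCast_val_eq_castHom hN]

/-- `f^{(2k-1-2u).val} = f` for an involution `f` (`N` even): a reflected exponent has the opposite
parity. [folklore] -/
theorem iterate_val_reflect (hN : Even N) (hf : Function.Involutive f) (k u : ZMod N) (a : α) :
    f^[(2 * k - 1 - 2 * u).val] a = f a := by
  have h : f^[(2 * k - 1 - 2 * u).val] = f^[1] := by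
    refine iterate_eq_iterate_of_natCast_eq hf ?_
    rw [natCast_val_eq_castHom hN, map_sub, map_sub, map_mul, map_mul, map_one, Nat.cast_one,
      map_ofNat _ 2]
    generalize ZMod.castHom hN.two_dvd (ZMod 2) k = a
    generalize ZMod.castHom hN.two_dvd (ZMod 2) u = b
    revert a b
    decide
  rw [h, Function.iterate_one]

/-- `f^{(1 : ℤ/Nℤ).val} = f` for `N` even and nonzero (so `N ≥ 2`). [folklore] -/
theorem iterate_val_one (hN : Even N) (f : α → α) (a : α) : f^[(1 : ZMod N).val] a = f a := by
  have h2 : 1 < N := by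
    obtain ⟨m, hm⟩ := hN
    have := NeZero.ne N
    omega
  rw [ZMod.val_one_eq_one_mod, Nat.mod_eq_of_lt h2, Function.iterate_one]

end Parity

/-! ### Four commuting involutions: the pattern word `x ↦ r₀^{x₀} r₁^{x₁} r₂^{x₂} r₃^{x₃} a` -/

section Four

variable {N : ℕ} [NeZero N] {α : Type*} (hN : Even N) (r : Fin 4 → α → α)
  (hr : ∀ i, Function.Involutive (r i)) (hrc : ∀ i j a, r i (r j a) = r j (r i a))
  {A : (Fin 4 → ZMod N) → α → α}
  (hA : ∀ x a, A x a =
    (r 0)^[(x 0).val] ((r 1)^[(x 1).val] ((r 2)^[(x 2).val] ((r 3)^[(x 3).val] a))))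

omit [NeZero N] in
include hA in
/-- `r^0 a = a`. [folklore] -/
theorem A_zero (a : α) : A 0 a = a := by
  simp [hA]

omit [NeZero N] in
include hA in
/-- `r^{z eᵢ} a = rᵢ^{z.val} a`. [folklore] -/
theorem A_single (i : Fin 4) (z : ZMod N) (a : α) : A (Pi.single i z) a = (r i)^[z.val] a := by
  rw [hA]
  fin_cases i <;> simp

include hN hr hrc hA in
/-- `r^{x+y} a = r^x (r^y a)` for commuting involutions (`N` even: parities of representatives are
additive). [folklore] -/
theorem A_add (x y : Fin 4 → ZMod N) (a : α) : A (x + y) a = A x (A y a) := by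
  have hc : ∀ i j (m n : ℕ) (b : α), (r i)^[m] ((r j)^[n] b) = (r j)^[n] ((r i)^[m] b) :=
    fun i j m n b => Function.Commute.iterate_iterate (fun b => hrc i j b) m n b
  simp only [hA, Pi.add_apply, iterate_val_add hN (hr _)]
  simp only [hc 0 1 (y 0).val (x 1).val, hc 0 2 (y 0).val (x 2).val, hc 0 3 (y 0).val (x 3).val,
    hc 1 2 (y 1).val (x 2).val, hc 1 3 (y 1).val (x 3).val, hc 2 3 (y 2).val (x 3).val]

include hN hr hrc hA in
/-- `rᵢ (r^x a) = r^x (rᵢ a)`. [folklore] -/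
theorem apply_A (i : Fin 4) (x : Fin 4 → ZMod N) (a : α) : r i (A x a) = A x (r i a) := by
  have e1 : A (Pi.single i 1 + x) a = r i (A x a) := by
    rw [A_add hN r hr hrc hA, A_single r hA, iterate_val_one hN]
  have e2 : A (Pi.single i 1 + x) a = A x (r i a) := by
    rw [add_comm, A_add hN r hr hrc hA, A_single r hA, iterate_val_one hN]
  exact e1.symm.trans e2

include hN hr hrc hA in
/-- **Pattern words are reflection symmetric**: `rᵢ (r^{θ_{i,k} c} a) = r^c a`, as the reflected
`i`-th coordinate `2k - 1 - cᵢ` has the parity opposite to `cᵢ` (`N` even).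
[cite: FrohlichIsraelLiebSimon1978, Thm. 4.3 (proof)] -/
theorem apply_A_cellReflect (i : Fin 4) (k : ZMod N) (c : BlockIdx 4 N) (a : α) :
    r i (A (cellReflect i k c) a) = A c a := by
  have h1 : cellReflect i k c = c + Pi.single i (2 * k - 1 - 2 * c i) := by
    ext j
    by_cases hj : j = i
    · subst hj; simp; ring
    · simp [hj]
  rw [h1, A_add hN r hr hrc hA, A_single r hA, iterate_val_reflect hN (hr i),
    apply_A hN r hr hrc hA, hr i]

include hN hr hrc hA in
/-- `Φ (pat (rᵢ a)) = Φ (pat a)`: the pattern word of `rᵢ a` is the translate by `eᵢ` of that of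
`a`. [cite: FrohlichIsraelLiebSimon1978, Thm. 4.3 (proof)] -/
theorem phi_pat_apply (Φ : (BlockIdx 4 N → α) → ℝ)
    (hcyc : ∀ (w : BlockIdx 4 N → α) (v : BlockIdx 4 N), Φ (fun c => w (c + v)) = Φ w)
    (i : Fin 4) (a : α) : Φ (fun x => A x (r i a)) = Φ (fun x => A x a) := by
  have : (fun x => A x (r i a)) = fun x => A (x + (Pi.single i 1 : BlockIdx 4 N)) a := by
    funext x
    rw [A_add hN r hr hrc hA, A_single r hA, iterate_val_one hN]
  rw [this]
  exact hcyc (fun x => A x a) (Pi.single i 1)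

include hN hr hrc hA in
/-- `Φ (pat (rᵢ^n a)) = Φ (pat a)`. [cite: FrohlichIsraelLiebSimon1978, Thm. 4.3 (proof)] -/
theorem phi_pat_iterate (Φ : (BlockIdx 4 N → α) → ℝ)
    (hcyc : ∀ (w : BlockIdx 4 N → α) (v : BlockIdx 4 N), Φ (fun c => w (c + v)) = Φ w)
    (i : Fin 4) (n : ℕ) (a : α) : Φ (fun x => A x ((r i)^[n] a)) = Φ (fun x => A x a) := by
  induction n with
  | zero => rfl
  | succ n ih => rw [Function.iterate_succ_apply', phi_pat_apply hN r hr hrc hA Φ hcyc, ih]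

include hN hr hrc hA in
/-- `Φ (pat (r^y a)) = Φ (pat a)`: all letters of a pattern word have pattern words of the same `Φ`.
[cite: FrohlichIsraelLiebSimon1978, Thm. 4.3 (proof)] -/
theorem phi_pat_A (Φ : (BlockIdx 4 N → α) → ℝ)
    (hcyc : ∀ (w : BlockIdx 4 N → α) (v : BlockIdx 4 N), Φ (fun c => w (c + v)) = Φ w)
    (y : BlockIdx 4 N) (a : α) : Φ (fun x => A x (A y a)) = Φ (fun x => A x a) := by
  simp only [hA y a, phi_pat_iterate hN r hr hrc hA Φ hcyc]

end Four

end Chessboard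

/-- **Stub `chessboard`** (Fröhlich–Israel–Lieb–Simon, CMP 62 (1978) Thms 4.1/4.3, letter form).
Cells of the even four-torus `(ℤ/N)⁴`; letters `α` (a finite alphabet) with four commuting
involutions `r i`; words `w : cells → α`; a real functional `Φ` on words which is translation
invariant, and for each axis `i` — with the half `H = {c | (c i).val < N/2}` and the cell reflection
`c ↦ c[i ↦ -1 - c i]` through the planes `0 | N/2` — non-negative on the reflection-symmetric words
`w|_H ∪ θ(w|_H)` and reflection Cauchy–Schwarz `Φ(w)² ≤ Φ(w|_H ∪ θ w|_H) · Φ(θ w|_{Hᶜ} ∪ w|_{Hᶜ})`.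
Then every universal pattern `c ↦ r₀^{c₀} r₁^{c₁} r₂^{c₂} r₃^{c₃} a` has `Φ ≥ 0`, and
`|Φ w|^{N⁴} ≤ ∏_c Φ(universal pattern of w c)`. [cite: FrohlichIsraelLiebSimon1978, Thm. 4.3] -/
theorem stub_chessboard {N : ℕ} [NeZero N] (hN : Even N) {α : Type*} [Fintype α] [DecidableEq α]
    (r : Fin 4 → α → α) (hr : ∀ i, Function.Involutive (r i))
    (hrc : ∀ i j a, r i (r j a) = r j (r i a))
    (Φ : ((Fin 4 → ZMod N) → α) → ℝ)
    (hcyc : ∀ (w : (Fin 4 → ZMod N) → α) (v : Fin 4 → ZMod N), Φ (fun c => w (c + v)) = Φ w)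
    (hpos : ∀ (i : Fin 4) (w : (Fin 4 → ZMod N) → α),
      0 ≤ Φ (fun c => if (c i).val < N / 2 then w c else r i (w (Function.update c i (-1 - c i)))))
    (hcs : ∀ (i : Fin 4) (w : (Fin 4 → ZMod N) → α),
      Φ w ^ 2 ≤
        Φ (fun c => if (c i).val < N / 2 then w c else r i (w (Function.update c i (-1 - c i)))) *
        Φ (fun c => if (c i).val < N / 2 then r i (w (Function.update c i (-1 - c i))) else w c)) :
    (∀ a : α, 0 ≤ Φ (fun c => (r 0)^[(c 0).val] ((r 1)^[(c 1).val] ((r 2)^[(c 2).val]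
        ((r 3)^[(c 3).val] a))))) ∧
    ∀ w : (Fin 4 → ZMod N) → α,
      |Φ w| ^ (N ^ 4) ≤ ∏ c : Fin 4 → ZMod N, Φ (fun x => (r 0)^[(x 0).val] ((r 1)^[(x 1).val]
        ((r 2)^[(x 2).val] ((r 3)^[(x 3).val] (w c))))) := by
  -- the symmetrisation operators and the letter action, with their defining formulas
  obtain ⟨P, hPd⟩ : ∃ P : Fin 4 → ZMod N → ((Fin 4 → ZMod N) → α) → (Fin 4 → ZMod N) → α,
      ∀ i k v c, P i k v c =
        if (c i - k).val < N / 2 then v c else r i (v (Function.update c i (2 * k - 1 - c i))) :=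
    ⟨_, fun _ _ _ _ => rfl⟩
  obtain ⟨M, hMd⟩ : ∃ M : Fin 4 → ZMod N → ((Fin 4 → ZMod N) → α) → (Fin 4 → ZMod N) → α,
      ∀ i k v c, M i k v c =
        if (c i - k).val < N / 2 then r i (v (Function.update c i (2 * k - 1 - c i))) else v c :=
    ⟨_, fun _ _ _ _ => rfl⟩
  obtain ⟨A, hA⟩ : ∃ A : (Fin 4 → ZMod N) → α → α, ∀ x a, A x a =
      (r 0)^[(x 0).val] ((r 1)^[(x 1).val] ((r 2)^[(x 2).val] ((r 3)^[(x 3).val] a))) :=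
    ⟨_, fun _ _ => rfl⟩
  -- the hypotheses at the boundary `0 | N/2` in terms of `P`, `M`
  have hP0 : ∀ i v, P i 0 v =
      fun c => if (c i).val < N / 2 then v c else r i (v (Function.update c i (-1 - c i))) :=
    fun i v => funext fun c => by rw [hPd]; simp only [sub_zero, mul_zero, zero_sub]
  have hM0 : ∀ i v, M i 0 v =
      fun c => if (c i).val < N / 2 then r i (v (Function.update c i (-1 - c i))) else v c :=
    fun i v => funext fun c => by rw [hMd]; simp only [sub_zero, mul_zero, zero_sub]
  have hpos0 : ∀ i v, 0 ≤ Φ (P i 0 v) := fun i v => by rw [hP0]; exact hpos i v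
  have hcs0 : ∀ i v, Φ v ^ 2 ≤ Φ (P i 0 v) * Φ (M i 0 v) := fun i v => by
    rw [hP0, hM0]; exact hcs i v
  -- pattern words are reflection symmetric (`cellReflect i k c = c[i ↦ 2k-1-cᵢ]` by definition)
  have hpatR : ∀ b i k c, r i ((fun x => A x b) (Function.update c i (2 * k - 1 - c i))) =
      (fun x => A x b) c :=
    fun b i k c => Chessboard.apply_A_cellReflect hN r hr hrc hA i k c b
  have h := stub_chessboardAux hN r P M hPd hMd Φ hcyc hpos0 hcs0 (fun b x => A x b)
    (fun b => Chessboard.A_zero r hA b) hpatR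
    (fun b c => Chessboard.phi_pat_A hN r hr hrc hA Φ hcyc c b)
    (fun i b => Chessboard.phi_pat_apply hN r hr hrc hA Φ hcyc i b) 0
  refine ⟨fun a => ?_, fun w => ?_⟩
  · simpa only [hA] using (h fun _ => a).1 a
  · simpa only [hA] using (h w).2

end Summit.QuantumFields.QCD.Theorems.UnquenchedChessboardBoundLine

end
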